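import Summits.AtomisticToContinuum.FouriersLaw.Theorems.BondHeatUncertaintyExtensiveSnapshotIrreversibilityTapDualityOddCorrectorAux1
import Summits.AtomisticToContinuum.FouriersLaw.Theorems.BondHeatUncertaintyExtensiveSnapshotIrreversibilityTotalGreenKuboCapAux1
import Summits.AtomisticToContinuum.FouriersLaw.Theorems.JunctionLocalitySuperadditiveResistanceKuboReversal

/-!
# Tap duality for the odd Kubo corrector, II: the duality inequality in density form

Helper file 2 (`--supports` stmt-AtomisticToContinuum-9121) for stub `stub_tapDualityOddCorrector`
(S_A) of line `tap-duality-gk-time` (crux `BondHeatUncertainty.ExtensiveSnapshotIrreversibility`).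
Pinned anharmonic chain `P = pinnedChain ω₂ lam β γ`, both baths at `T > 0`, Gibbs weight
`ρ = e^{-H/T}`, momentum flip `Θ(q,p) = (q,-p)`, taps `∂_b = ∂_{p_b}` at the bath sites
(`bw_b = [b = 0] + [b = N-1]`).

* `sq_sum_mul_le_mul_sum_of_sq_le` — weighted Cauchy–Schwarz for finite sums from the termwise
  inequalities `X_i² ≤ a_i c_i` (discriminant of `t ↦ Σ_i B_i (a_i t² + 2 X_i t + c_i) ≥ 0`).
* `sq_integral_oddPart_sq_le` — **tap duality, PDE form**: for classical `L²(μ_T)` solutions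
  `u, v ∈ C²` of `L u = -k` (`k` continuous, odd, in `L²`) and `L v = -uo`, `uo = ½(u - u∘Θ)` the odd
  part of `u`:  `(∫ uo² ρ)² ≤ (∫ u k ρ) · (∫ v uo ρ)`.  Proof: the polarised Green identity
  (`Kubo.polar`) `∫ (v k + u uo) ρ = 2γT Σ_b bw_b ∫ ∂_b u ∂_b v ρ`; the cross Green identity
  (`Kubo.cross`) for the forward pair `(u, k)` against the backward pair `(v∘Θ, -uo)` (`Kubo.rev_pair`)
  and oddness of `k`, `uo` give `∫ v k ρ = ∫ u uo ρ = ∫ uo² ρ`; hence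
  `∫ uo² ρ = γT Σ_b bw_b ∫ ∂_b u ∂_b v ρ ≤ √(γT Σ_b bw_b ∫ (∂_b u)² ρ) √(γT Σ_b bw_b ∫ (∂_b v)² ρ)`
  `= √(∫ u k ρ) √(∫ v uo ρ)` (Cauchy–Schwarz per bath site, `sq_integral_mul_mul_gibbsDensity_le`,
  and the tap energy identities `integral_mul_source_eq_dirichlet`).
* `tapDuality_density` — **tap duality, Green–Kubo form (unnormalised)**: for a smooth `u` with
  `L u = -J` (`J` the total current) and `|u| ≤ K e^{ϑH}` (`2ϑ < 1/T`): the Green–Kubo integrand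
  `t ↦ ∫ uo · P_t uo ρ` is integrable on `(0,∞)` and
  `(∫ uo² ρ)² ≤ (∫ u J ρ) · ∫₀^∞ ∫ uo · P_t uo ρ dt` — part I's smooth Poisson solution
  `v = ∫₀^∞ P_t uo dt` (`poisson_smooth_of_decay`, `forecast_decay_of_odd`) and `pairing_fubini`.
* `helper_tapDualityDensity` — the registered closed form of `tapDuality_density`.

References: Kundu–Dhar–Narayan 2009 (the corrector); Eckmann–Pillet–Rey-Bellet 1999 §3; folklore.
No definitions, no named facts; nothing here closes the item.
-/

noncomputable section

open MeasureTheory ProbabilityTheory Filter Topology Set Function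
open scoped NNReal ENNReal ContDiff
open Literature.MathematicalPhysics.KineticTheory.HeatConduction
open Literature.MathematicalPhysics.KineticTheory OscillatorChain
open Summit.AtomisticToContinuum.FouriersLaw.Theorems.SuperadditiveResistance.DeviceLiouville
open Summit.AtomisticToContinuum.FouriersLaw.Theorems.SuperadditiveResistance.Kubo
open Summit.AtomisticToContinuum.FouriersLaw.Theorems.SubdiffusiveBondHeat
open Summit.AtomisticToContinuum.FouriersLaw.Theorems.OddSectorIrreversibility
open Summit.AtomisticToContinuum.FouriersLaw.Theorems.OddSectorIrreversibility.Corrector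

namespace Summit.AtomisticToContinuum.FouriersLaw.Theorems.ExtensiveSnapshotIrreversibility.TapDuality

variable {N : ℕ}

/-- **Weighted Cauchy–Schwarz from termwise inequalities.** If `B_i ≥ 0`, `a_i, c_i ≥ 0` and
`X_i² ≤ a_i c_i` whenever `B_i > 0`, then `(Σ_i B_i X_i)² ≤ (Σ_i B_i a_i)(Σ_i B_i c_i)`: the quadratic
`t ↦ Σ_i B_i (a_i t² + 2 X_i t + c_i)` is nonnegative, so its discriminant is `≤ 0`. [folklore] -/
theorem sq_sum_mul_le_mul_sum_of_sq_le {ι : Type*} [Fintype ι] (B X a c : ι → ℝ)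
    (hB : ∀ i, 0 ≤ B i) (ha : ∀ i, 0 ≤ a i) (hc : ∀ i, 0 ≤ c i)
    (h : ∀ i, 0 < B i → X i ^ 2 ≤ a i * c i) :
    (∑ i, B i * X i) ^ 2 ≤ (∑ i, B i * a i) * ∑ i, B i * c i := by
  have hterm : ∀ (t : ℝ) (i : ι), 0 ≤ B i * (a i * (t * t) + 2 * X i * t + c i) := by
    intro t i
    rcases (hB i).eq_or_lt with h0 | hpos
    · rw [← h0, zero_mul]
    · refine mul_nonneg hpos.le ?_
      have hX := h i hpos
      have hai := ha i
      have hci := hc i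
      rcases hai.eq_or_lt with ha0 | hapos
      · have hX0 : X i = 0 := by
          have h' : X i ^ 2 ≤ 0 := by rw [← ha0, zero_mul] at hX; exact hX
          exact pow_eq_zero_iff two_ne_zero |>.1 (le_antisymm h' (sq_nonneg _))
        rw [← ha0, hX0]
        simpa using hci
      · have key : 0 ≤ a i * (a i * (t * t) + 2 * X i * t + c i) := by
          nlinarith [sq_nonneg (a i * t + X i)]
        exact nonneg_of_mul_nonneg_right key hapos
  have hrepr : ∀ t : ℝ, (∑ i, B i * a i) * (t * t) + (2 * ∑ i, B i * X i) * t + ∑ i, B i * c i =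
      ∑ i, B i * (a i * (t * t) + 2 * X i * t + c i) := by
    intro t
    rw [Finset.sum_mul, Finset.mul_sum, Finset.sum_mul, ← Finset.sum_add_distrib,
      ← Finset.sum_add_distrib]
    exact Finset.sum_congr rfl fun i _ => by ring
  have hq : ∀ t : ℝ, 0 ≤ (∑ i, B i * a i) * (t * t) + (2 * ∑ i, B i * X i) * t + ∑ i, B i * c i :=
    fun t => by rw [hrepr t]; exact Finset.sum_nonneg fun i _ => hterm t i
  have hd := discrim_le_zero hq
  rw [discrim] at hd
  nlinarith [hd]

section PDE

variable {ω₂ lam β γ : ℝ} (hω : 0 < ω₂) (hl : 0 ≤ lam) (hβ : 0 ≤ β) (hγ : 0 < γ) {T : ℝ} (hT : 0 < T)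
include hω hl hβ hγ hT

/-- **Tap duality, PDE form.** For the pinned chain (`ω₂ > 0`, `lam, β ≥ 0`, `γ > 0`), `T > 0`,
`ρ = e^{-H/T}`: let `u, v ∈ C² ∩ L²(μ_T)`, `k ∈ C ∩ L²(μ_T)` odd under the momentum flip,
`L_{T,T} u = -k` and `L_{T,T} v = -uo` pointwise, where `uo = ½(u - u∘Θ)` is the odd part of `u`. Then
`(∫ uo² ρ)² ≤ (∫ u k ρ)(∫ v uo ρ)`.  The polarised Green identity gives
`∫ (v k + u uo) ρ = 2γT Σ_b bw_b ∫ ∂_b u ∂_b v ρ`, the cross Green identity for `(u, k)` against the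
reversed pair `(v∘Θ, -uo)` gives `∫ v k ρ = ∫ u uo ρ = ∫ uo² ρ`, and Cauchy–Schwarz per bath site
closes with the two tap energy identities. [folklore] -/
theorem sq_integral_oddPart_sq_le {u v k uo : PhaseSpace N → ℝ} (hu : ContDiff ℝ 2 u)
    (hv : ContDiff ℝ 2 v) (hu2 : MemLp u 2 ((pinnedChain ω₂ lam β γ).gibbsMeasure N T))
    (hv2 : MemLp v 2 ((pinnedChain ω₂ lam β γ).gibbsMeasure N T)) (hkc : Continuous k)
    (hk2 : MemLp k 2 ((pinnedChain ω₂ lam β γ).gibbsMeasure N T))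
    (hkodd : ∀ x : PhaseSpace N, k (x.1, -x.2) = -k x)
    (huo : uo = fun x => (u x - u (x.1, -x.2)) / 2)
    (hpu : ∀ x, (pinnedChain ω₂ lam β γ).generator N T T u x = -k x)
    (hpv : ∀ x, (pinnedChain ω₂ lam β γ).generator N T T v x = -uo x) :
    (∫ x, uo x ^ 2 * (pinnedChain ω₂ lam β γ).gibbsDensity N T x) ^ 2 ≤
      (∫ x, u x * k x * (pinnedChain ω₂ lam β γ).gibbsDensity N T x) *
        ∫ x, v x * uo x * (pinnedChain ω₂ lam β γ).gibbsDensity N T x := by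
  set P := pinnedChain ω₂ lam β γ with hP
  set ρ := P.gibbsDensity N T with hρ
  set B := OscillatorChain.bathWeight N with hB
  have hB0 : ∀ i, 0 ≤ B i := Corrector.bathWeight_nonneg N
  have hρ0 : ∀ x, 0 < ρ x := fun x => P.gibbsDensity_pos N T x
  -- the odd part: pointwise form, continuity, oddness, `L²`
  have huo_apply : ∀ x, uo x = (u x - rev u x) / 2 := fun x => by rw [huo]; rfl
  have huc : Continuous u := hu.continuous
  have hvc : Continuous v := hv.continuous
  have huoc : Continuous uo := by
    rw [huo]; exact (huc.sub (continuous_rev huc)).div_const 2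
  have huoodd : ∀ x : PhaseSpace N, uo (x.1, -x.2) = -uo x := fun x => by
    rw [huo_apply, huo_apply, rev_apply, rev_apply]
    simp only [neg_neg, Prod.mk.eta]
    ring
  have hum2 : MemLp (rev u) 2 (P.gibbsMeasure N T) := memLp_rev hω hl hβ N hT huc hu2
  have huo2 : MemLp uo 2 (P.gibbsMeasure N T) := by
    refine ((hu2.sub hum2).const_mul (1 / 2 : ℝ)).ae_eq (ae_of_all _ fun x => ?_)
    rw [huo_apply x, Pi.sub_apply]
    ring
  -- the two Poisson equations in operator form, and the reversed pair `(rev v, -uo)`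
  have hpu' : ∀ x, 1 * liouvilleOp P N u x + γ * bathOp N B T u x = -k x := fun x => by
    rw [one_mul, ← hpu x, generator_eq_liouvilleOp_add]; rfl
  have hpv' : ∀ x, 1 * liouvilleOp P N v x + γ * bathOp N B T v x = -uo x := fun x => by
    rw [one_mul, ← hpv x, generator_eq_liouvilleOp_add]; rfl
  have hprv : ∀ x, -1 * liouvilleOp P N (rev v) x + γ * bathOp N B T (rev v) x = -(-uo x) :=
    fun x => by rw [rev_pair P B T 1 γ hpv' x, rev_apply, huoodd]
  have hrv : ContDiff ℝ 2 (rev v) := contDiff_rev hv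
  have hrv2 : MemLp (rev v) 2 (P.gibbsMeasure N T) := memLp_rev hω hl hβ N hT hvc hv2
  have huo2n : MemLp (fun x => -uo x) 2 (P.gibbsMeasure N T) := huo2.neg
  -- integrability of the pairings
  have i_uuo : Integrable fun x => u x * uo x * ρ x :=
    integrable_mul_mul_gibbsDensity hω hl hβ γ N hT hu2 huo2
  have i_ruuo : Integrable fun x => rev u x * uo x * ρ x :=
    integrable_mul_mul_gibbsDensity hω hl hβ γ N hT hum2 huo2
  have i_vk : Integrable fun x => v x * k x * ρ x :=
    integrable_mul_mul_gibbsDensity hω hl hβ γ N hT hv2 hk2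
  -- (1) the polarised Green identity
  have hpol : ∫ x, (v x * k x + u x * uo x) * ρ x =
      2 * γ * T * ∑ i, B i * ∫ x, partialP i u x * partialP i v x * ρ x :=
    polar hω hl hβ N hT B hB0 1 hγ hu hv hu2 hv2 hk2 huo2 hpu' hpv'
  -- (2) the cross Green identity: `∫ v k ρ = ∫ u uo ρ`
  have hcr : ∫ x, rev v x * k x * ρ x = ∫ x, u x * (-uo x) * ρ x :=
    cross hω hl hβ N hT B hB0 1 hγ hu hrv hu2 hrv2 hk2 huo2n hpu' hprv
  have hL : ∫ x, rev v x * k x * ρ x = -∫ x, v x * k x * ρ x := by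
    have e : (fun x => rev v x * k x * ρ x) = fun x => rev (fun y => -(v y * k y)) x * ρ x := by
      funext x
      simp only [rev_apply, hkodd]
      ring
    rw [e, integral_rev_mul_gibbsDensity P T (fun y => -(v y * k y)), ← integral_neg]
    exact integral_congr_ae (ae_of_all _ fun x => by ring)
  have hR : ∫ x, u x * (-uo x) * ρ x = -∫ x, u x * uo x * ρ x := by
    rw [← integral_neg]
    exact integral_congr_ae (ae_of_all _ fun x => by ring)
  have hvk : ∫ x, v x * k x * ρ x = ∫ x, u x * uo x * ρ x := by
    rw [hL, hR] at hcr
    linarith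
  -- (3) `∫ u uo ρ = ∫ uo² ρ` (flip invariance of `ρ dx`, oddness of `uo`)
  have hrefl : ∫ x, rev u x * uo x * ρ x = -∫ x, u x * uo x * ρ x := by
    have e : (fun x => rev u x * uo x * ρ x) = fun x => rev (fun y => -(u y * uo y)) x * ρ x := by
      funext x
      simp only [rev_apply, huoodd]
      ring
    rw [e, integral_rev_mul_gibbsDensity P T (fun y => -(u y * uo y)), ← integral_neg]
    exact integral_congr_ae (ae_of_all _ fun x => by ring)
  have hsq : ∫ x, uo x ^ 2 * ρ x =
      (1 / 2) * ((∫ x, u x * uo x * ρ x) - ∫ x, rev u x * uo x * ρ x) := by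
    rw [← integral_sub i_uuo i_ruuo, ← integral_const_mul]
    refine integral_congr_ae (ae_of_all _ fun x => ?_)
    show uo x ^ 2 * ρ x = 1 / 2 * (u x * uo x * ρ x - rev u x * uo x * ρ x)
    rw [huo_apply x]
    ring
  have hI : ∫ x, uo x ^ 2 * ρ x = ∫ x, u x * uo x * ρ x := by rw [hsq, hrefl]; ring
  -- (4) `∫ uo² ρ = γ T Σ_b bw_b ∫ ∂_b u ∂_b v ρ`
  have hsum : ∫ x, (v x * k x + u x * uo x) * ρ x =
      (∫ x, v x * k x * ρ x) + ∫ x, u x * uo x * ρ x := by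
    rw [← integral_add i_vk i_uuo]
    exact integral_congr_ae (ae_of_all _ fun x => by ring)
  have hIX : ∫ x, uo x ^ 2 * ρ x = γ * T * ∑ i, B i * ∫ x, partialP i u x * partialP i v x * ρ x := by
    rw [hsum, hvk, ← hI] at hpol
    linarith
  -- (5) the tap energy identities
  have hA : ∫ x, u x * k x * ρ x = γ * T * ∑ i, B i * ∫ x, partialP i u x ^ 2 * ρ x :=
    integral_mul_source_eq_dirichlet hω hl hβ hγ hT hu hu2 hkc hk2 hpu
  have hG : ∫ x, v x * uo x * ρ x = γ * T * ∑ i, B i * ∫ x, partialP i v x ^ 2 * ρ x :=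
    integral_mul_source_eq_dirichlet hω hl hβ hγ hT hv hv2 huoc huo2 hpv
  -- (6) Cauchy–Schwarz per bath site, then over the sites
  have hCSi : ∀ i, 0 < B i → (∫ x, partialP i u x * partialP i v x * ρ x) ^ 2 ≤
      (∫ x, partialP i u x ^ 2 * ρ x) * ∫ x, partialP i v x ^ 2 * ρ x := by
    intro i hi
    have hdu : MemLp (partialP i u) 2 (P.gibbsMeasure N T) :=
      memLp_partialP_of_poisson hω hl hβ hγ hT hu hu2 hk2 hpu hi
    have hdv : MemLp (partialP i v) 2 (P.gibbsMeasure N T) :=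
      memLp_partialP_of_poisson hω hl hβ hγ hT hv hv2 huo2 hpv hi
    exact sq_integral_mul_mul_gibbsDensity_le hω hl hβ hT γ hdu hdv
  have ha0 : ∀ i, 0 ≤ ∫ x, partialP i u x ^ 2 * ρ x :=
    fun i => integral_nonneg fun x => mul_nonneg (sq_nonneg _) (hρ0 x).le
  have hc0 : ∀ i, 0 ≤ ∫ x, partialP i v x ^ 2 * ρ x :=
    fun i => integral_nonneg fun x => mul_nonneg (sq_nonneg _) (hρ0 x).le
  have hCS := sq_sum_mul_le_mul_sum_of_sq_le B (fun i => ∫ x, partialP i u x * partialP i v x * ρ x)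
    (fun i => ∫ x, partialP i u x ^ 2 * ρ x) (fun i => ∫ x, partialP i v x ^ 2 * ρ x) hB0 ha0 hc0 hCSi
  calc (∫ x, uo x ^ 2 * ρ x) ^ 2
      = (γ * T) ^ 2 * (∑ i, B i * ∫ x, partialP i u x * partialP i v x * ρ x) ^ 2 := by rw [hIX]; ring
    _ ≤ (γ * T) ^ 2 * ((∑ i, B i * ∫ x, partialP i u x ^ 2 * ρ x) *
          ∑ i, B i * ∫ x, partialP i v x ^ 2 * ρ x) := mul_le_mul_of_nonneg_left hCS (sq_nonneg _)
    _ = (∫ x, u x * k x * ρ x) * ∫ x, v x * uo x * ρ x := by rw [hA, hG]; ring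

end PDE

section GreenKubo

variable {ω₂ lam β γ : ℝ} (hω : 0 < ω₂) (hl : 0 < lam) (hβ : 0 < β) (hγ : 0 < γ) {T : ℝ} (hT : 0 < T)
  (hN : 0 < N)
include hω hl hβ hγ hT hN

/-- **Tap duality, Green–Kubo form (unnormalised).** For the pinned chain (all parameters `> 0`),
`N ≥ 1`, `T > 0`, `ρ = e^{-H/T}`, the total current `J = Σ_i j_i`, and a smooth `u` with
`L_{T,T} u = -J` pointwise and `|u| ≤ K e^{ϑH}` (`0 < ϑ`, `2ϑ < 1/T`): with `uo = ½(u - u∘Θ)` and the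
forecasts `P_t uo (z) = ∫ uo dP_t(z,·)`, the Green–Kubo integrand `t ↦ ∫ uo · P_t uo ρ` is integrable
on `(0,∞)` and `(∫ uo² ρ)² ≤ (∫ u J ρ) · ∫_{(0,∞)} ∫ uo · P_t uo ρ dt`. The smooth Poisson solution
`v` of `L v = -uo` with `v = ∫₀^∞ P_t uo dt` a.e. (`poisson_smooth_of_decay`, decay of the odd
observable `uo` by `forecast_decay_of_odd`) turns `∫ v uo ρ` of the PDE form into the Green–Kubo
integral (`pairing_fubini`). [folklore] -/
theorem tapDuality_density {ϑ K : ℝ} (hϑ : 0 < ϑ) (h2ϑ : 2 * ϑ < 1 / T) {u uo : PhaseSpace N → ℝ}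
    (hu : ContDiff ℝ ∞ u)
    (hpde : ∀ x, (pinnedChain ω₂ lam β γ).generator N T T u x =
      -(∑ i : Fin N, (pinnedChain ω₂ lam β γ).bondCurrent N i x))
    (hub : ∀ x, |u x| ≤ K * Real.exp (ϑ * (pinnedChain ω₂ lam β γ).hamiltonian N x))
    (huo : uo = fun x => (u x - u (x.1, -x.2)) / 2) :
    IntegrableOn (fun t : ℝ => ∫ z, uo z *
        (∫ y, uo y ∂((pinnedChain ω₂ lam β γ).transitionKernel N T T t.toNNReal z)) *
          (pinnedChain ω₂ lam β γ).gibbsDensity N T z) (Ioi 0) ∧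
    (∫ z, uo z ^ 2 * (pinnedChain ω₂ lam β γ).gibbsDensity N T z) ^ 2 ≤
      (∫ z, u z * (∑ i : Fin N, (pinnedChain ω₂ lam β γ).bondCurrent N i z) *
          (pinnedChain ω₂ lam β γ).gibbsDensity N T z) *
        ∫ t in Ioi (0 : ℝ), ∫ z, uo z *
          (∫ y, uo y ∂((pinnedChain ω₂ lam β γ).transitionKernel N T T t.toNNReal z)) *
            (pinnedChain ω₂ lam β γ).gibbsDensity N T z := by
  set P := pinnedChain ω₂ lam β γ with hP
  set ρ := P.gibbsDensity N T with hρ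
  set Hm := P.hamiltonian N with hHm
  set J : PhaseSpace N → ℝ := fun x => ∑ i : Fin N, P.bondCurrent N i x with hJ
  have hϑT : ϑ < 1 / T := by linarith
  -- the total current
  have hJc : Continuous J := continuous_totalBondCurrent ω₂ lam β γ N
  obtain ⟨M, -, hJM⟩ := abs_totalBondCurrent_le_exp hω.le hl.le hβ.le γ N hϑ
  have hJ2 : MemLp J 2 (P.gibbsMeasure N T) := memLp_two_of_abs_le_exp hω hl.le hβ.le hT γ hJc h2ϑ hJM
  have hJodd : ∀ x : PhaseSpace N, J (x.1, -x.2) = -J x := fun x => totalBondCurrent_neg_momentum P N x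
  have hpde' : ∀ x, P.generator N T T u x = -J x := hpde
  -- the smooth solution and its odd part
  have huc : Continuous u := hu.continuous
  have hK : 0 ≤ K := by
    have h0 : 0 ≤ K * Real.exp (ϑ * Hm 0) := (abs_nonneg _).trans (hub 0)
    exact nonneg_of_mul_nonneg_left h0 (Real.exp_pos _)
  have hu2 : MemLp u 2 (P.gibbsMeasure N T) := memLp_two_of_abs_le_exp hω hl.le hβ.le hT γ huc h2ϑ hub
  have huo_apply : ∀ x, uo x = (u x - u (x.1, -x.2)) / 2 := fun x => by rw [huo]
  have huos : ContDiff ℝ ∞ uo := by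
    rw [huo]; exact (hu.sub (hu.comp (contDiff_fst.prodMk contDiff_snd.neg))).div_const 2
  have huoc : Continuous uo := huos.continuous
  have huoodd : ∀ x : PhaseSpace N, uo (x.1, -x.2) = -uo x := fun x => by
    rw [huo_apply, huo_apply x]
    simp only [neg_neg, Prod.mk.eta]
    ring
  have huob : ∀ x, |uo x| ≤ K * Real.exp (ϑ * Hm x) := by
    intro x
    have h1 := hub x
    have h2 : |u (x.1, -x.2)| ≤ K * Real.exp (ϑ * Hm x) := by
      have h := hub (x.1, -x.2)
      rwa [show Hm (x.1, -x.2) = Hm x from OscillatorChain.hamiltonian_neg_momentum P N x] at h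
    rw [huo_apply, abs_div, abs_two]
    have h3 := abs_sub (u x) (u (x.1, -x.2))
    linarith
  -- decay of the forecasts of `uo`, and the smooth Poisson solution `v`
  obtain ⟨M₁, c, -, hc, hdecay⟩ := forecast_decay_of_odd hω hl hβ hγ hT hN hϑ hϑT hK huoc huoodd huob
  obtain ⟨v, hv, hvae, hpv, K', -, hvb⟩ :=
    poisson_smooth_of_decay hω hl hβ hγ hT hN hϑ hϑT hc huos huob hdecay
  have hv2 : MemLp v 2 (P.gibbsMeasure N T) :=
    memLp_two_of_abs_le_exp hω hl.le hβ.le hT γ hv.continuous h2ϑ hvb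
  -- the PDE form
  have hpde2 : (∫ z, uo z ^ 2 * ρ z) ^ 2 ≤ (∫ z, u z * J z * ρ z) * ∫ z, v z * uo z * ρ z :=
    sq_integral_oddPart_sq_le hω hl.le hβ.le hγ hT (hu.of_le (by norm_cast)) (hv.of_le (by norm_cast))
      hu2 hv2 hJc hJ2 hJodd huo hpde' hpv
  -- the Green–Kubo integral is `∫ v uo ρ`
  obtain ⟨hint, hfub⟩ := pairing_fubini hω hl hβ hT hγ.le h2ϑ hc huoc huoc huob hdecay
  refine ⟨hint, ?_⟩
  have hGK : ∫ t in Ioi (0 : ℝ), ∫ z, uo z *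
      (∫ y, uo y ∂(P.transitionKernel N T T t.toNNReal z)) * ρ z = ∫ z, v z * uo z * ρ z := by
    rw [hfub]
    refine integral_congr_ae ?_
    filter_upwards [hvae] with z hz
    rw [← hz]
    ring
  rw [hGK]
  exact hpde2

end GreenKubo

/-! ## Registered helper stub -/

/-- **Registered helper stub of this file** (`helper_tapDualityDensity`, sub-goal of stub
`stub_tapDualityOddCorrector` of crux stmt-AtomisticToContinuum-9121): tap duality in unnormalised
Green–Kubo form for the smooth corrector (= `tapDuality_density`). [folklore] -/
theorem helper_tapDualityDensity : ∀ ω₂ lam β γ : ℝ, 0 < ω₂ → 0 < lam → 0 < β → 0 < γ → ∀ (N : ℕ), 0 < N → ∀ T : ℝ, 0 < T → ∀ ϑ K : ℝ, 0 < ϑ → 2 * ϑ < 1 / T → ∀ u uo : PhaseSpace N → ℝ, ContDiff ℝ (⊤ : ℕ∞) u → (∀ x, (pinnedChain ω₂ lam β γ).generator N T T u x = -(∑ i : Fin N, (pinnedChain ω₂ lam β γ).bondCurrent N i x)) → (∀ x, |u x| ≤ K * Real.exp (ϑ * (pinnedChain ω₂ lam β γ).hamiltonian N x)) → (uo = fun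 x => (u x - u (x.1, -x.2)) / 2) → IntegrableOn (fun t : ℝ => ∫ z, uo z * (∫ y, uo y ∂((pinnedChain ω₂ lam β γ).transitionKernel N T T t.toNNReal z)) * (pinnedChain ω₂ lam β γ).gibbsDensity N T z) (Set.Ioi 0) ∧ (∫ z, uo z ^ 2 * (pinnedChain ω₂ lam β γ).gibbsDensity N T z) ^ 2 ≤ (∫ z, u z * (∑ i : Fin N, (pinnedChain ω₂ lam β γ).bondCurrent N i z) * (pinnedChain ω₂ lam β γ).gibbsDensity N T z) * ∫ t in Set.Ioi (0 : ℝ), ∫ z, uo z * (∫ y, uo y ∂((pinnedChain ω₂ lam β γ).transitionKernel N T T t.toNNReal z)) * (pinnedChain ω₂ lam β γ).gibbsDensity N T z :=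
  fun _ _ _ _ hω hl hβ hγ _ hN _ hT _ _ hϑ h2ϑ _ _ hu hpde hub huo =>
    tapDuality_density hω hl hβ hγ hT hN hϑ h2ϑ hu hpde hub huo

end Summit.AtomisticToContinuum.FouriersLaw.Theorems.ExtensiveSnapshotIrreversibility.TapDuality

end
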